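import Summits.AtomisticToContinuum.Crystallization.Theorems.ExcessDecayLiouvilleLevelMasses

/-!
# Route `ExcessDecayLiouville`: one Caccioppoli LEVEL of the linear interior estimate (linear levels, II)

Linear half of the harmonic-replacement architecture for item `ExcessDecay` (stmt-AtomisticToContinuum-9334): a field
`f` (bounded, finitely supported) which is `L`-harmonic on the sites of a ball, `(L f)(p) = 0` for `dist p c₀ ≤ ρ_f`,
has its lattice differences `D_τ f = f(· + Aτ) − f` controlled in `ℓ²` on a smaller ball by its own local `ℓ²` mass
and a far term:

* `level_estimate_work`, `level_estimate` : for `f` with operator rows `Gf` (resp. `0`) on `dist · c₀ ≤ ρ_f`,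
  `1 ≤ R`, `2R + 2 ≤ ρ_f`, `τ ∈ Λ₀` (`‖Aτ‖ ≤ 2`) with domination constant `M_τ`, any `μ > 0` and `F ⊆ S ∩ B_R(c₀)`,
  `κ Σ_{x ∈ F} ‖f x − f(x + Aτ)‖² ≤ M_τ [ Σ'η²⟪Gf,f⟫ + (19C₆/R²) M(f; 3R+2) + 19μF₈(R) M(f; 2R+2) + 19μ⁻¹ TT(f; c₀, 2R+2, R) ]`
  (radial site cutoff `η` at radii `R+2 < 2R+2 ≤ ρ_f`; the work term vanishes in the harmonic case);
* `sum_cross_sub_sq_le_nnForm`, `level_estimate_work_cross`, `level_estimate_cross` : the same for the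
  cross-sublattice difference `f x − f (x + (t 1 − t 0))` over sites of sublattice `0` (domination constant `1`).

All `[folklore]`; helper lemmas, nothing here closes an item.
-/

noncomputable section

namespace Summit.AtomisticToContinuum.Crystallization.Theorems.ExcessDecayLiouville

open scoped BigOperators Topology InnerProductSpace RealInnerProductSpace Classical
open Literature.MathematicalPhysics.StatisticalMechanics
open Summit.AtomisticToContinuum.Crystallization.Theorems.PhononStabilityNegative

-- Local notation: the force-constant map `K(e)w = h(|e|²)w + 2⟪e,w⟫h′(|e|²)e`.
local notation3 "𝕂[" e "] " w:max =>
  (-((‖e‖ ^ 2)⁻¹) ^ 7 + ((‖e‖ ^ 2)⁻¹) ^ 4) • w + (2 * ⟪e, w⟫ * (7 * ((‖e‖ ^ 2)⁻¹) ^ 8 - 4 * ((‖e‖ ^ 2)⁻¹) ^ 5)) • e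
set_option quotPrecheck false in
local notation "𝟙ᵇ[" x ", " c ", " R "]" => (if dist (x : EuclideanSpace ℝ (Fin 3)) c ≤ R then (1 : ℝ) else 0)
set_option quotPrecheck false in
local notation "𝔣[" ρ ", " p ", " q "]" =>
  (if ρ < dist (p : EuclideanSpace ℝ (Fin 3)) q then (dist (p : EuclideanSpace ℝ (Fin 3)) q)⁻¹ ^ 8 else (0 : ℝ))

section

variable {t : Fin 2 → (EuclideanSpace ℝ (Fin 3))} {A : (EuclideanSpace ℝ (Fin 3)) →L[ℝ] (EuclideanSpace ℝ (Fin 3))}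

set_option quotPrecheck false in
-- Local notation: the operator row `(L v)(p)`.
local notation "𝕃" v:max " @ " p:max =>
  tsum (fun q : Sites₀ t A => (if ((p : Sites₀ t A) : EuclideanSpace ℝ (Fin 3)) ≠ q then
    𝕂[((p : Sites₀ t A) : EuclideanSpace ℝ (Fin 3)) - q] (v ((p : Sites₀ t A) : EuclideanSpace ℝ (Fin 3)) - v q) else 0))

/-! ## One Caccioppoli level -/

/-- **One Caccioppoli level, with work term.** For a finitely supported `h` whose operator rows equal `Gf` on the
sites with `dist · c₀ ≤ ρ_h`, `1 ≤ R`, `2R + 2 ≤ ρ_h`, a lattice vector `τ` (`‖Aτ‖ ≤ 2`) with domination constant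
`M_τ`, and a weight `μ > 0`: with the radial site cutoff `η` (`≡ 1` up to radius `R + 2`, `≡ 0` from `2R + 2`,
`1/R`-Lipschitz),
(`F ⊆ S ∩ B_R(c₀)`) `κ Σ_{x ∈ F} ‖h x − h(x + Aτ)‖² ≤ M_τ [ Σ' η² ⟪Gf, h⟫ + (19C₆/R²) M(h; 2R+2+R) + 19μF₈(R) M(h; 2R+2)
  + 19μ⁻¹ TT(h; c₀, 2R+2, R) ]`. [folklore] -/
theorem level_estimate_work (hA : Adm₀ A) (hI : Inner₀ t A) {κ : ℝ} (hκ0 : 0 ≤ κ)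
    (hκ : ∀ v : (EuclideanSpace ℝ (Fin 3)) → (EuclideanSpace ℝ (Fin 3)), (Function.support v).Finite →
      Function.support v ⊆ Sites₀ t A → κ * nnForm t A v ≤ ∑' p : Sites₀ t A, ⟪𝕃 v @ p, v p⟫)
    {h : (EuclideanSpace ℝ (Fin 3)) → (EuclideanSpace ℝ (Fin 3))} (hh : (Function.support h).Finite)
    {c₀ : EuclideanSpace ℝ (Fin 3)} {R : ℝ} (hR : 1 ≤ R) {ρh : ℝ} (hρh : 2 * R + 2 ≤ ρh)
    {Gf : (EuclideanSpace ℝ (Fin 3)) → (EuclideanSpace ℝ (Fin 3))}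
    (hharm : ∀ p : Sites₀ t A, dist (p : EuclideanSpace ℝ (Fin 3)) c₀ ≤ ρh → 𝕃 h @ p = Gf p)
    {τ : EuclideanSpace ℝ (Fin 3)} (hτ : τ ∈ Λ₀) (hτ2 : ‖A τ‖ ≤ 2) {Mτ : ℝ} (hM : 0 ≤ Mτ)
    (hdom : ∀ v : (EuclideanSpace ℝ (Fin 3)) → (EuclideanSpace ℝ (Fin 3)), (Function.support v).Finite →
      ∑' p : Sites₀ t A, ‖v p - v ((p : (EuclideanSpace ℝ (Fin 3))) + A τ)‖ ^ 2 ≤ Mτ * nnForm t A v)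
    {μ : ℝ} (hμ : 0 < μ) (F : Finset (EuclideanSpace ℝ (Fin 3)))
    (hF : ∀ x ∈ F, x ∈ Sites₀ t A ∧ dist x c₀ ≤ R) :
    κ * ∑ x ∈ F, ‖h x - h (x + A τ)‖ ^ 2 ≤
      Mτ * ((∑' p : Sites₀ t A, (if (p : EuclideanSpace ℝ (Fin 3)) ∈ Sites₀ t A then
          max (min 1 ((R + 2 + R - dist (p : EuclideanSpace ℝ (Fin 3)) c₀) / R)) 0 else 0) ^ 2 * ⟪Gf p, h p⟫) +
      (19 * (1024 / ((23 / 25 : ℝ) ^ 3 * (23 / 25 : ℝ) ^ 3)) / R ^ 2 * (∑' p : Sites₀ t A, ‖h p‖ ^ 2 * 𝟙ᵇ[p, c₀, 2 * R + 2 + R]) +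
      19 * μ * (1024 / ((23 / 25 : ℝ) ^ 3 * R ^ 5)) * (∑' p : Sites₀ t A, ‖h p‖ ^ 2 * 𝟙ᵇ[p, c₀, 2 * R + 2]) +
      19 * μ⁻¹ * (∑' p : Sites₀ t A, ∑' q : Sites₀ t A, (if (p : (EuclideanSpace ℝ (Fin 3))) ≠ q then
        𝔣[R, p, q] * 𝟙ᵇ[p, c₀, 2 * R + 2] * ‖h q‖ ^ 2 else 0)))) := by
  obtain ⟨B, hB⟩ := exists_norm_le_of_finite hh
  have hR0 : 0 < R := by linarith
  set η : (EuclideanSpace ℝ (Fin 3)) → ℝ := fun x => if x ∈ Sites₀ t A then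
      max (min 1 ((R + 2 + R - dist x c₀) / R)) 0 else 0 with hηdef
  have hη : (Function.support η).Finite := siteCutoff_support_finite hA hI c₀ (R + 2) hR0
  have hηS : Function.support η ⊆ Sites₀ t A := siteCutoff_support_subset (t := t) (A := A) c₀ (R + 2) R
  have hη0 : ∀ x, 0 ≤ η x := fun x => siteCutoff_nonneg (t := t) (A := A) c₀ (R + 2) R x
  have hη1 : ∀ x, η x ≤ 1 := fun x => siteCutoff_le_one (t := t) (A := A) c₀ (R + 2) R x
  have hηR : ∀ p : Sites₀ t A, 2 * R + 2 < dist (p : (EuclideanSpace ℝ (Fin 3))) c₀ → η p = 0 := fun p hp =>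
    siteCutoff_eq_zero_of_le (t := t) (A := A) hR0 (by linarith)
  have hlip : ∀ p q : Sites₀ t A, |η p - η q| ≤ ‖(p : (EuclideanSpace ℝ (Fin 3))) - q‖ / R := fun p q =>
    abs_siteCutoff_sub_le (t := t) (A := A) (c := c₀) (r₁ := R + 2) hR0 p q
  have hF' : ∀ x ∈ F, x ∈ Sites₀ t A ∧ η x = 1 ∧ η (x + A τ) = 1 := by
    intro x hx
    obtain ⟨hxS, hxd⟩ := hF x hx
    refine ⟨hxS, siteCutoff_eq_one (t := t) (A := A) hR0 hxS (by linarith), siteCutoff_eq_one (t := t) (A := A) hR0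
      (add_mem_sites₀ hxS hτ) ?_⟩
    have := dist_triangle (x + A τ) x c₀
    have h2 : dist (x + A τ) x = ‖A τ‖ := by rw [dist_eq_norm, add_sub_cancel_left]
    linarith
  have key := gradient_estimate_tail_weighted_of_cutoff_of_dom (c := c₀) (R := 2 * R + 2) (ρ := R) (μ := μ) hA hI hκ0 hκ
    hh hB hη hηS hη0 hη1 hR hμ hηR hlip hτ hM hdom F hF'
  have hwork : (∑' p : Sites₀ t A, (η p) ^ 2 * ⟪𝕃 h @ p, h p⟫) = ∑' p : Sites₀ t A, (η p) ^ 2 * ⟪Gf p, h p⟫ := by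
    refine tsum_congr fun p => ?_
    by_cases hp : η p = 0
    · rw [hp]
      ring
    · have hd : dist (p : EuclideanSpace ℝ (Fin 3)) c₀ < R + 2 + R := by
        by_contra hcon
        exact hp (siteCutoff_eq_zero_of_le (t := t) (A := A) hR0 (not_lt.1 hcon))
      rw [hharm p (by linarith)]
  rw [hwork] at key
  exact key

/-- **One Caccioppoli level (harmonic case).** As `level_estimate_work` with `Gf = 0` (`h` is `L`-harmonic on the
sites with `dist · c₀ ≤ ρ_h`): the work term vanishes and
`κ Σ_{x ∈ F} ‖h x − h(x + Aτ)‖² ≤ M_τ [ (19C₆/R²) M(h; 2R+2+R) + 19μF₈(R) M(h; 2R+2) + 19μ⁻¹ TT(h; c₀, 2R+2, R) ]`.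
[folklore] -/
theorem level_estimate (hA : Adm₀ A) (hI : Inner₀ t A) {κ : ℝ} (hκ0 : 0 ≤ κ)
    (hκ : ∀ v : (EuclideanSpace ℝ (Fin 3)) → (EuclideanSpace ℝ (Fin 3)), (Function.support v).Finite →
      Function.support v ⊆ Sites₀ t A → κ * nnForm t A v ≤ ∑' p : Sites₀ t A, ⟪𝕃 v @ p, v p⟫)
    {h : (EuclideanSpace ℝ (Fin 3)) → (EuclideanSpace ℝ (Fin 3))} (hh : (Function.support h).Finite)
    {c₀ : EuclideanSpace ℝ (Fin 3)} {R : ℝ} (hR : 1 ≤ R) {ρh : ℝ} (hρh : 2 * R + 2 ≤ ρh)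
    (hharm : ∀ p : Sites₀ t A, dist (p : EuclideanSpace ℝ (Fin 3)) c₀ ≤ ρh → 𝕃 h @ p = 0)
    {τ : EuclideanSpace ℝ (Fin 3)} (hτ : τ ∈ Λ₀) (hτ2 : ‖A τ‖ ≤ 2) {Mτ : ℝ} (hM : 0 ≤ Mτ)
    (hdom : ∀ v : (EuclideanSpace ℝ (Fin 3)) → (EuclideanSpace ℝ (Fin 3)), (Function.support v).Finite →
      ∑' p : Sites₀ t A, ‖v p - v ((p : (EuclideanSpace ℝ (Fin 3))) + A τ)‖ ^ 2 ≤ Mτ * nnForm t A v)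
    {μ : ℝ} (hμ : 0 < μ) (F : Finset (EuclideanSpace ℝ (Fin 3)))
    (hF : ∀ x ∈ F, x ∈ Sites₀ t A ∧ dist x c₀ ≤ R) :
    κ * ∑ x ∈ F, ‖h x - h (x + A τ)‖ ^ 2 ≤
      Mτ * ((19 * (1024 / ((23 / 25 : ℝ) ^ 3 * (23 / 25 : ℝ) ^ 3)) / R ^ 2 * (∑' p : Sites₀ t A, ‖h p‖ ^ 2 * 𝟙ᵇ[p, c₀, 2 * R + 2 + R]) +
      19 * μ * (1024 / ((23 / 25 : ℝ) ^ 3 * R ^ 5)) * (∑' p : Sites₀ t A, ‖h p‖ ^ 2 * 𝟙ᵇ[p, c₀, 2 * R + 2]) +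
      19 * μ⁻¹ * (∑' p : Sites₀ t A, ∑' q : Sites₀ t A, (if (p : (EuclideanSpace ℝ (Fin 3))) ≠ q then
        𝔣[R, p, q] * 𝟙ᵇ[p, c₀, 2 * R + 2] * ‖h q‖ ^ 2 else 0)))) := by
  have key := level_estimate_work hA hI hκ0 hκ hh hR hρh (Gf := fun _ : EuclideanSpace ℝ (Fin 3) => (0 : EuclideanSpace ℝ (Fin 3))) hharm hτ hτ2 hM hdom hμ F hF
  have h0 : (∑' p : Sites₀ t A, (if (p : EuclideanSpace ℝ (Fin 3)) ∈ Sites₀ t A then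
      max (min 1 ((R + 2 + R - dist (p : EuclideanSpace ℝ (Fin 3)) c₀) / R)) 0 else 0) ^ 2 *
        ⟪(fun _ : EuclideanSpace ℝ (Fin 3) => (0 : EuclideanSpace ℝ (Fin 3))) p, h p⟫) = 0 := by
    simp only [inner_zero_left, mul_zero, tsum_zero]
  rw [h0, zero_add] at key
  exact key

/-! ## The cross-sublattice level estimate -/

/-- **Finite cross-sublattice difference sums are dominated by the strain form**: for `F` a finite set of sites
of sublattice `0`, `Σ_{x ∈ F} ‖v x − v (x + (t 1 − t 0))‖² ≤ nnForm t A v`. [folklore] -/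
theorem sum_cross_sub_sq_le_nnForm (hA : Adm₀ A) (hI : Inner₀ t A)
    {v : (EuclideanSpace ℝ (Fin 3)) → (EuclideanSpace ℝ (Fin 3))} (hv : (Function.support v).Finite)
    (F : Finset (EuclideanSpace ℝ (Fin 3))) (hF : ∀ x ∈ F, ∃ z ∈ Λ₀, x = t 0 + A z) :
    ∑ x ∈ F, ‖v x - v (x + (t 1 - t 0))‖ ^ 2 ≤ nnForm t A v := by
  classical
  have hFS : ∀ x ∈ F, x ∈ Sites₀ t A := fun x hx => by
    obtain ⟨z, hz, hxz⟩ := hF x hx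
    exact ⟨0, z, hz, hxz⟩
  set G : Finset (Sites₀ t A) := F.attach.image (fun x => ⟨x.1, hFS x.1 x.2⟩) with hG
  have hinj : Set.InjOn (fun x : {x // x ∈ F} => (⟨x.1, hFS x.1 x.2⟩ : Sites₀ t A)) (F.attach : Set {x // x ∈ F}) := by
    intro a _ b _ hab
    have : (a : (EuclideanSpace ℝ (Fin 3))) = b := congrArg (fun s : Sites₀ t A => (s : (EuclideanSpace ℝ (Fin 3)))) hab
    exact Subtype.ext this
  have hrow : ∀ p : Sites₀ t A, (∃ z ∈ Λ₀, (p : EuclideanSpace ℝ (Fin 3)) = t 0 + A z) →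
      ‖v p - v ((p : EuclideanSpace ℝ (Fin 3)) + (t 1 - t 0))‖ ^ 2 ≤
        ∑' q : Sites₀ t A, (if dist (p : EuclideanSpace ℝ (Fin 3)) q ≤ 11 / 10 then ‖v p - v q‖ ^ 2 else 0) := by
    rintro p ⟨z, hz, hpz⟩
    have hq : (p : EuclideanSpace ℝ (Fin 3)) + (t 1 - t 0) ∈ Sites₀ t A := ⟨1, z, hz, by rw [hpz]; abel⟩
    have h := (summable_nnRow hA hI v p).le_tsum ⟨_, hq⟩ (fun q _ => by positivity)
    have hd : dist (p : EuclideanSpace ℝ (Fin 3)) ((p : EuclideanSpace ℝ (Fin 3)) + (t 1 - t 0)) ≤ 11 / 10 := by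
      rw [dist_eq_norm, sub_add_cancel_left, norm_neg]
      exact norm_t_sub_t_le hA hI
    simp only [hd, if_true] at h
    exact h
  have h1 : ∑ x ∈ F, ‖v x - v (x + (t 1 - t 0))‖ ^ 2 =
      ∑ p ∈ G, ‖v p - v ((p : EuclideanSpace ℝ (Fin 3)) + (t 1 - t 0))‖ ^ 2 := by
    rw [hG, Finset.sum_image hinj, ← Finset.sum_attach F]
  rw [h1]
  calc ∑ p ∈ G, ‖v p - v ((p : EuclideanSpace ℝ (Fin 3)) + (t 1 - t 0))‖ ^ 2
      ≤ ∑ p ∈ G, ∑' q : Sites₀ t A, (if dist (p : EuclideanSpace ℝ (Fin 3)) q ≤ 11 / 10 then ‖v p - v q‖ ^ 2 else 0) := by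
        refine Finset.sum_le_sum fun p hp => hrow p ?_
        rw [hG, Finset.mem_image] at hp
        obtain ⟨x, _, rfl⟩ := hp
        exact hF x.1 x.2
    _ ≤ nnForm t A v := by
        unfold nnForm
        exact (summable_nnRows hA hI hv).sum_le_tsum G (fun p _ => tsum_nonneg fun q => by positivity)

/-- **One Caccioppoli level for the CROSS-SUBLATTICE difference, with work term.** As `level_estimate_work`, for
the difference `h x − h (x + (t 1 − t 0))` over a finite set `F` of sites of sublattice `0` in `B_R(c₀)`
(domination constant `1`). [folklore] -/
theorem level_estimate_work_cross (hA : Adm₀ A) (hI : Inner₀ t A) {κ : ℝ} (hκ0 : 0 ≤ κ)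
    (hκ : ∀ v : (EuclideanSpace ℝ (Fin 3)) → (EuclideanSpace ℝ (Fin 3)), (Function.support v).Finite →
      Function.support v ⊆ Sites₀ t A → κ * nnForm t A v ≤ ∑' p : Sites₀ t A, ⟪𝕃 v @ p, v p⟫)
    {h : (EuclideanSpace ℝ (Fin 3)) → (EuclideanSpace ℝ (Fin 3))} (hh : (Function.support h).Finite)
    {c₀ : EuclideanSpace ℝ (Fin 3)} {R : ℝ} (hR : 1 ≤ R) {ρh : ℝ} (hρh : 2 * R + 2 ≤ ρh)
    {Gf : (EuclideanSpace ℝ (Fin 3)) → (EuclideanSpace ℝ (Fin 3))}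
    (hharm : ∀ p : Sites₀ t A, dist (p : EuclideanSpace ℝ (Fin 3)) c₀ ≤ ρh → 𝕃 h @ p = Gf p)
    {μ : ℝ} (hμ : 0 < μ) (F : Finset (EuclideanSpace ℝ (Fin 3)))
    (hF : ∀ x ∈ F, (∃ z ∈ Λ₀, x = t 0 + A z) ∧ dist x c₀ ≤ R) :
    κ * ∑ x ∈ F, ‖h x - h (x + (t 1 - t 0))‖ ^ 2 ≤
      (∑' p : Sites₀ t A, (if (p : EuclideanSpace ℝ (Fin 3)) ∈ Sites₀ t A then
          max (min 1 ((R + 2 + R - dist (p : EuclideanSpace ℝ (Fin 3)) c₀) / R)) 0 else 0) ^ 2 * ⟪Gf p, h p⟫) +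
      (19 * (1024 / ((23 / 25 : ℝ) ^ 3 * (23 / 25 : ℝ) ^ 3)) / R ^ 2 * (∑' p : Sites₀ t A, ‖h p‖ ^ 2 * 𝟙ᵇ[p, c₀, 2 * R + 2 + R]) +
      19 * μ * (1024 / ((23 / 25 : ℝ) ^ 3 * R ^ 5)) * (∑' p : Sites₀ t A, ‖h p‖ ^ 2 * 𝟙ᵇ[p, c₀, 2 * R + 2]) +
      19 * μ⁻¹ * (∑' p : Sites₀ t A, ∑' q : Sites₀ t A, (if (p : (EuclideanSpace ℝ (Fin 3))) ≠ q then
        𝔣[R, p, q] * 𝟙ᵇ[p, c₀, 2 * R + 2] * ‖h q‖ ^ 2 else 0))) := by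
  classical
  obtain ⟨B, hB⟩ := exists_norm_le_of_finite hh
  have hR0 : 0 < R := by linarith
  set η : (EuclideanSpace ℝ (Fin 3)) → ℝ := fun x => if x ∈ Sites₀ t A then
      max (min 1 ((R + 2 + R - dist x c₀) / R)) 0 else 0 with hηdef
  have hη : (Function.support η).Finite := siteCutoff_support_finite hA hI c₀ (R + 2) hR0
  have hηS : Function.support η ⊆ Sites₀ t A := siteCutoff_support_subset (t := t) (A := A) c₀ (R + 2) R
  have hη0 : ∀ x, 0 ≤ η x := fun x => siteCutoff_nonneg (t := t) (A := A) c₀ (R + 2) R x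
  have hη1 : ∀ x, η x ≤ 1 := fun x => siteCutoff_le_one (t := t) (A := A) c₀ (R + 2) R x
  have hηR : ∀ p : Sites₀ t A, 2 * R + 2 < dist (p : (EuclideanSpace ℝ (Fin 3))) c₀ → η p = 0 := fun p hp =>
    siteCutoff_eq_zero_of_le (t := t) (A := A) hR0 (by linarith)
  have hlip : ∀ p q : Sites₀ t A, |η p - η q| ≤ ‖(p : (EuclideanSpace ℝ (Fin 3))) - q‖ / R := fun p q =>
    abs_siteCutoff_sub_le (t := t) (A := A) (c := c₀) (r₁ := R + 2) hR0 p q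
  have hC := caccioppoli_l2_tail_weighted (c := c₀) (R := 2 * R + 2) (ρ := R) (μ := μ) hA hI hκ hh hB hη hηS hη0 hη1
    hR hμ hηR hlip
  have ha : (Function.support fun x : (EuclideanSpace ℝ (Fin 3)) => η x • h x).Finite :=
    hη.subset fun x hx => by
      simp only [Function.mem_support, ne_eq, smul_eq_zero, not_or] at hx ⊢
      exact hx.1
  have hD := sum_cross_sub_sq_le_nnForm hA hI ha F (fun x hx => (hF x hx).1)
  have hF1 : ∀ x ∈ F, η x = 1 ∧ η (x + (t 1 - t 0)) = 1 := by
    intro x hx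
    obtain ⟨⟨z, hz, hxz⟩, hxd⟩ := hF x hx
    have hxS : x ∈ Sites₀ t A := ⟨0, z, hz, hxz⟩
    have hyS : x + (t 1 - t 0) ∈ Sites₀ t A := ⟨1, z, hz, by rw [hxz]; abel⟩
    refine ⟨siteCutoff_eq_one (t := t) (A := A) hR0 hxS (by linarith), siteCutoff_eq_one (t := t) (A := A) hR0 hyS ?_⟩
    have := dist_triangle (x + (t 1 - t 0)) x c₀
    have h2 : dist (x + (t 1 - t 0)) x ≤ 11 / 10 := by
      rw [dist_eq_norm, add_sub_cancel_left]
      exact norm_t_sub_t_le hA hI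
    linarith
  have hpart : ∑ x ∈ F, ‖h x - h (x + (t 1 - t 0))‖ ^ 2 =
      ∑ x ∈ F, ‖η x • h x - η (x + (t 1 - t 0)) • h (x + (t 1 - t 0))‖ ^ 2 := by
    refine Finset.sum_congr rfl fun x hx => ?_
    obtain ⟨hx1, hx2⟩ := hF1 x hx
    simp only [hx1, hx2, one_smul]
  have hwork : (∑' p : Sites₀ t A, (η p) ^ 2 * ⟪𝕃 h @ p, h p⟫) = ∑' p : Sites₀ t A, (η p) ^ 2 * ⟪Gf p, h p⟫ := by
    refine tsum_congr fun p => ?_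
    by_cases hp : η p = 0
    · rw [hp]
      ring
    · have hd : dist (p : EuclideanSpace ℝ (Fin 3)) c₀ < R + 2 + R := by
        by_contra hcon
        exact hp (siteCutoff_eq_zero_of_le (t := t) (A := A) hR0 (not_lt.1 hcon))
      rw [hharm p (by linarith)]
  rw [hwork] at hC
  calc κ * ∑ x ∈ F, ‖h x - h (x + (t 1 - t 0))‖ ^ 2
      = κ * ∑ x ∈ F, ‖η x • h x - η (x + (t 1 - t 0)) • h (x + (t 1 - t 0))‖ ^ 2 := by rw [hpart]
    _ ≤ κ * nnForm t A (fun x => η x • h x) := mul_le_mul_of_nonneg_left hD hκ0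
    _ ≤ _ := hC

/-- **One Caccioppoli level for the cross-sublattice difference (harmonic case)**: `Gf = 0`. [folklore] -/
theorem level_estimate_cross (hA : Adm₀ A) (hI : Inner₀ t A) {κ : ℝ} (hκ0 : 0 ≤ κ)
    (hκ : ∀ v : (EuclideanSpace ℝ (Fin 3)) → (EuclideanSpace ℝ (Fin 3)), (Function.support v).Finite →
      Function.support v ⊆ Sites₀ t A → κ * nnForm t A v ≤ ∑' p : Sites₀ t A, ⟪𝕃 v @ p, v p⟫)
    {h : (EuclideanSpace ℝ (Fin 3)) → (EuclideanSpace ℝ (Fin 3))} (hh : (Function.support h).Finite)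
    {c₀ : EuclideanSpace ℝ (Fin 3)} {R : ℝ} (hR : 1 ≤ R) {ρh : ℝ} (hρh : 2 * R + 2 ≤ ρh)
    (hharm : ∀ p : Sites₀ t A, dist (p : EuclideanSpace ℝ (Fin 3)) c₀ ≤ ρh → 𝕃 h @ p = 0)
    {μ : ℝ} (hμ : 0 < μ) (F : Finset (EuclideanSpace ℝ (Fin 3)))
    (hF : ∀ x ∈ F, (∃ z ∈ Λ₀, x = t 0 + A z) ∧ dist x c₀ ≤ R) :
    κ * ∑ x ∈ F, ‖h x - h (x + (t 1 - t 0))‖ ^ 2 ≤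
      19 * (1024 / ((23 / 25 : ℝ) ^ 3 * (23 / 25 : ℝ) ^ 3)) / R ^ 2 * (∑' p : Sites₀ t A, ‖h p‖ ^ 2 * 𝟙ᵇ[p, c₀, 2 * R + 2 + R]) +
      19 * μ * (1024 / ((23 / 25 : ℝ) ^ 3 * R ^ 5)) * (∑' p : Sites₀ t A, ‖h p‖ ^ 2 * 𝟙ᵇ[p, c₀, 2 * R + 2]) +
      19 * μ⁻¹ * (∑' p : Sites₀ t A, ∑' q : Sites₀ t A, (if (p : (EuclideanSpace ℝ (Fin 3))) ≠ q then
        𝔣[R, p, q] * 𝟙ᵇ[p, c₀, 2 * R + 2] * ‖h q‖ ^ 2 else 0)) := by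
  have key := level_estimate_work_cross hA hI hκ0 hκ hh hR hρh
    (Gf := fun _ : EuclideanSpace ℝ (Fin 3) => (0 : EuclideanSpace ℝ (Fin 3))) hharm hμ F hF
  have h0 : (∑' p : Sites₀ t A, (if (p : EuclideanSpace ℝ (Fin 3)) ∈ Sites₀ t A then
      max (min 1 ((R + 2 + R - dist (p : EuclideanSpace ℝ (Fin 3)) c₀) / R)) 0 else 0) ^ 2 *
        ⟪(fun _ : EuclideanSpace ℝ (Fin 3) => (0 : EuclideanSpace ℝ (Fin 3))) p, h p⟫) = 0 := by
    simp only [inner_zero_left, mul_zero, tsum_zero]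
  rw [h0, zero_add] at key
  exact key

end

end Summit.AtomisticToContinuum.Crystallization.Theorems.ExcessDecayLiouville

end
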